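import Summits.QuantumFields.YangMills.Theorems.BalabanUVNodesN07RegimeTokFlatOfRecordSmall
import HarnessLib

/-!
# N07 ∕ K0ᴬ — NEGATIVE LEMMA: AT THE FLAT SCHEME OF RECORD WITH THE IN-THE-SMALL DOMAIN `dom := {V | ‖𝔄(V)‖ < t}`, THE KNIT TOKENS (rng) ∧ (star_mem) ARE UNINHABITABLE
# for EVERY `t > 0`, every `Kc` and every other datum — the domain contains the JUNK-FAR coarse field `V ≡ −1` (the log series of `B(V) = (1∕i)log V` diverges there, so
# `B(−1) = 0 = B(1)`, `𝔄(−1) = 0 = 𝔄(1)`), at which the tokens demand `Ū(S.chartCfg 1) = −1` as well as `= 1`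

Cell `pub-ymgap`, width seat `pub-ymgap-dag-n07-w3` (g28), INTENT-4 ∕ CLAIM-4 (LOCATED-g28-3 with its KERNEL CERTIFICATE).  `--kind proof --supports stmt-QuantumFields-27238 --as helper`;
count-neutral; the pattern of ✓`…K0AxTangentSocketConsNeg` (a negative lemma about DISPLAYED hypotheses, not about the crux).  [15] = [Balaban1985Variational].

WHAT IS REFUTED (kernel, sorry-free, standard axioms; `N = 2`, `U₀ = 1`, any level `k`, ANY data `levB Gp Δ2 a hposπ hpos♭ hQ ε_C B₀ C₄ a₃ j a𝔄 ε₄`, any regularity `ε`, any `t > 0`):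
★★★ `knitTokens_flatDom_false` — for `S = bgSchemeOfRecord F 2 K k Ω 1 {V | ‖frakAOfRecordAtBg128 … 1 … V‖ < t} levB Gp Δ2 a hposπ hpos♭ hQ ε_C B₀ C₄ a₃ j a𝔄 ε₄` and every `Kc`,
(rng) `∀ V ∈ S.dom, ∀ A ∈ Kc V, S.chart V A ∈ bgReg F 2 K k ε ∧ Ū^k(S.chart V A) = V` together with (star_mem) `∀ V ∈ S.dom, S.sol V ∈ Kc V` imply `False`.
Hence ★★★ `not_exists_knitTokens_flatDom`: NO `Kc` carries the flat road's KNIT package at `S_t` — the finals ✓p826658 `…OfProp4W`, ✓p826780 `…PrintGreen`, ✓p827017 `…FlatLetters`,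
✓p827690 `…OfKnitTokens` (g27) and ✓p828177 `…OfKnitTokensModGauge` (this seat) — all typed over exactly this `S_t` (`Δ2 := 0`, level `k + 1`) — are VACUOUS-AS-TYPED: kernel-true
implications from an uninhabitable antecedent.

WHY (the located junk, by name).  `dom := {V | ‖𝔄(V)‖ < t}` is NOT a small neighbourhood of `1`: `𝔄 = H₁ ∘ B` (✓`frakAOfRecordAtBg128_eq`) with `B(V)(c) = (1∕i)·mlog(V(c)·(Ū^k 1)(c)⋆) = (1∕i)·mlog(V(c))`
(✓`BOfRecord_apply`, ✓`avOfRecord_iter_one`), and `mlog X = logOnePlus (X − 1) = ∑' n, logSeriesCoeff n • (X − 1)^n` is a `tsum` — ZERO where the series does not converge.  At `X = −1 ∈ SU(2)` (the field `V₋ := suOfMat 2 (−1)`, `suOfMat` transparent there),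
`X − 1 = −2·1` and `‖logSeriesCoeff n • (−2)^n • 1‖ = 2^n ∕ n ≥ 1`, so the series diverges and `mlog(−1) = 0` (§1 `mlog_neg_one_eq_zero`).  Therefore the constant coarse field `V₋ ≡ −1` has
`B(V₋) = 0`, `𝔄(V₋) = 0` (§2), so `V₋ ∈ S.dom` for every `t > 0`, exactly like `1 ∈ S.dom` (✓`frakAOfRecordAtBg128_one`); and since the scheme's `𝒢, W, J, bg` do not depend on `V` and
`𝔄(V₋) = 𝔄(1)`, `S.sol V₋ = S.sol 1` and `S.chart V₋ = S.chart 1` (§3).  (rng) at `A := S.sol V` (∈ `Kc V` by (star_mem)) for `V = 1` and `V = V₋` then gives `1 = Ū^k(S.chart 1 (S.sol 1)) = V₋`,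
i.e. `(1 : SU(2)) = −1` — false (§4).  NO analysis, no Regime, no smallness is used: the witness is a junk value of the tree's power-series logarithm admitted by the set-builder domain.

CURE (cheap; for whoever re-presses the flat road): intersect the domain with the log-disc, e.g. `dom := {V | ‖𝔄 V‖ < t ∧ ∀ c, ‖(V c : M₂(ℂ)) − 1‖ < 1}` (still `∈ 𝓝 1`, `RegimeTok` restricts), or
use a metric ball around `Ū^kU₀`.  This does NOT touch LOCATED-g28-2 (the chart's missing linearizing transformation (47)), which concerns every `dom ∈ 𝓝 1`.

HONEST LABELS.  A negative lemma on DISPLAYED hypotheses of count-neutral helper finals; no landed theorem is wrong (all kernel-true); nothing of Bałaban refuted (print's (7)-domain is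
`|V(∂p) − 1| < ε₁`-small, not a `tsum`-junk set); K0ᴬ ⟨27238⟩ NOT closed and NOT refuted; N07 NOT discharged; R4 is the conditional finite-𝕋⁴ rung `BalabanLadder.UV` only; finite torus, fixed
`ε` — nothing continuum ∕ OS ∕ Clay.  **The Yang–Mills mass gap is NOT proved (nor disproved) by any of this.**  No `sorry`, no `def`, no `instance ∕ notation`; standard axioms.
-/

set_option autoImplicit false

noncomputable section

open Filter Topology
open scoped Matrix Matrix.Norms.L2Operator InnerProductSpace

namespace Summit.QuantumFields.YangMills.Theorems.N07FlatDomKnitTokensNeg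

open Literature.MathematicalPhysics.QuantumFieldTheory.Balaban1983to89
open Literature.MathematicalPhysics.QuantumFieldTheory.Balaban1983to89.T4Continuum (T4Family)
open Literature.MathematicalPhysics.QuantumFieldTheory.Balaban1983to89.Node00
open Literature.Analysis.Complex (logOnePlus logSeriesCoeff)
open MatrixLog (mlog)
open NormedSpace (exp)
open B11Eq103H1Complex (SiteL2K BondL2K)
open B11Eq115Space (NegSize NegSup)
open B11Eq174Chart (solA)
open Summit.QuantumFields.YangMills.Theorems.N07RegimeTokFlatOfRecordSmall (frakAOfRecordAtBg128_one)

/-! ## §1  The junk value `mlog(−1) = 0` in `M₂(ℂ)` (the logarithmic series diverges at `X − 1 = −2·1`) -/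

/-- The terms of the logarithmic series at `x = −2·1 ∈ M₂(ℂ)` have norm `2^n ∕ n ≥ 1` (`n ≥ 1`), so the series is NOT summable. [folklore] -/
theorem not_summable_logSeries_neg_two :
    ¬ Summable (fun n : ℕ => logSeriesCoeff n • ((-2 : ℂ) • (1 : Matrix (Fin 2) (Fin 2) ℂ)) ^ n) := by
  intro hs
  have hlim := hs.tendsto_atTop_zero
  have hnorm : Tendsto (fun n : ℕ => ‖logSeriesCoeff n • ((-2 : ℂ) • (1 : Matrix (Fin 2) (Fin 2) ℂ)) ^ n‖) atTop (𝓝 0) := by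
    have h := hlim.norm
    rwa [norm_zero] at h
  have hev := (hnorm.eventually (gt_mem_nhds (show (0 : ℝ) < 1 by norm_num))).and (eventually_ge_atTop 1)
  obtain ⟨n, hn, hn1⟩ := hev.exists
  -- the norm of the `n`-th term is `2^n / n ≥ 1`
  have hterm : ‖logSeriesCoeff n • ((-2 : ℂ) • (1 : Matrix (Fin 2) (Fin 2) ℂ)) ^ n‖ = (2 : ℝ) ^ n / n := by
    rw [smul_pow, one_pow, smul_smul, norm_smul, norm_one, mul_one, norm_mul, norm_pow, logSeriesCoeff, norm_div, norm_pow, norm_neg, norm_one,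
      one_pow, Complex.norm_natCast, norm_neg, Complex.norm_ofNat]
    ring
  rw [hterm] at hn
  have hn' : (n : ℝ) ≤ (2 : ℝ) ^ n := by exact_mod_cast (Nat.lt_two_pow_self (n := n)).le
  have hnpos : (0 : ℝ) < n := by exact_mod_cast hn1
  have : (1 : ℝ) ≤ (2 : ℝ) ^ n / n := by rw [le_div_iff₀ hnpos, one_mul]; exact hn'
  linarith

/-- ★ **THE JUNK VALUE**: in `M₂(ℂ)` the tree's power-series logarithm of `−1` is `0` (`mlog X = ∑' n, logSeriesCoeff n • (X − 1)^n`, not summable at `X − 1 = −2·1`, and a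
non-summable `tsum` is `0`). [folklore] [cite: Balaban1985Averaging, (21) p.21 (the series, «for |X − 1| < 1» only)] -/
theorem mlog_neg_one_eq_zero : mlog (-1 : Matrix (Fin 2) (Fin 2) ℂ) = 0 := by
  have h2 : (-1 : Matrix (Fin 2) (Fin 2) ℂ) - 1 = (-2 : ℂ) • (1 : Matrix (Fin 2) (Fin 2) ℂ) := by
    rw [neg_smul, two_smul]; abel
  rw [MatrixLog.mlog_def, h2]
  exact tsum_eq_zero_of_not_summable not_summable_logSeries_neg_two

/-! ## §2  The junk-far coarse field `V₋ ≡ −1 ∈ SU(2)` and its letters `B(V₋) = 0`, `𝔄(V₋) = 0` -/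

/-- The total retraction `suOfMat` is transparent at `−1 ∈ SU(2)` (membership: unitary and `det(−1) = (−1)² = 1`; cf. the tree's `…DimensionGapSU2.neg_one_mem`, re-derived inline
to keep this leaf's imports inside the Bałaban cone). [folklore] -/
theorem coe_suOfMat_neg_one : ((suOfMat 2 (-1 : Matrix (Fin 2) (Fin 2) ℂ) : SU 2) : Matrix (Fin 2) (Fin 2) ℂ) = -1 := by
  have hmem : (-1 : Matrix (Fin 2) (Fin 2) ℂ) ∈ Matrix.specialUnitaryGroup (Fin 2) ℂ := by
    rw [Matrix.mem_specialUnitaryGroup_iff]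
    refine ⟨?_, ?_⟩
    · rw [Matrix.mem_unitaryGroup_iff, star_neg, star_one, neg_mul_neg, one_mul]
    · rw [Matrix.det_neg, Matrix.det_one, mul_one, Fintype.card_fin]; norm_num
  rw [suOfMat_of_mem hmem]

section Record

variable (F : T4Family) (K : ℕ) (k : ℕ) (Ω : ℕ → Set (Site (F.P K) 0))
  [Fact (0 < (F.L : ℝ))] [Fact (0 < (F.P K).eta k)] [Fact (0 < c0Rec F K k)] [Fact (∀ c, 0 < wBRec F K k c)]
  (levB : PBond (F.P K) k → ℕ)
  {Gp : SiteL2K ℂ (F.P K).d (fun _ => (F.P K).sitesPerDir 0) (c0Rec F K k) (WRec 2) →ₗ[ℂ]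
    SiteL2K ℂ (F.P K).d (fun _ => (F.P K).sitesPerDir 0) (c0Rec F K k) (WRec 2)}
  {Δ2 : BondL2K ℂ (F.P K).d (fun _ => (F.P K).sitesPerDir 0) (c0Rec F K k) (WRec 2) →ₗ[ℂ]
    BondL2K ℂ (F.P K).d (fun _ => (F.P K).sitesPerDir 0) (c0Rec F K k) (WRec 2)} (a : ℝ)
  (hposπ : ∀ x, x ≠ 0 → 0 < RCLike.re ⟪x, laplaceAOfRecordAt F 2 k (1 : GaugeField (F.P K) 0 (SU 2))
    (hessOpOfRecord128 F 2 k (1 : GaugeField (F.P K) 0 (SU 2)) Gp (QflatOfRecord F 2 k) Δ2)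
    (QOfRecord F 2 k (1 : GaugeField (F.P K) 0 (SU 2))) (QflatOfRecord F 2 k) a x⟫_ℂ)
  (hposb : ∀ x, x ≠ 0 → 0 < RCLike.re ⟪x, laplaceAOfRecord F 2 k (1 : GaugeField (F.P K) 0 (SU 2))
    (QOfRecord F 2 k (1 : GaugeField (F.P K) 0 (SU 2))) (QflatOfRecord F 2 k) a x⟫_ℂ)
  (hQ : Function.Surjective (QOfRecord F 2 k (1 : GaugeField (F.P K) 0 (SU 2))))

omit [Fact (0 < (F.L : ℝ))] [Fact (0 < (F.P K).eta k)] [Fact (0 < c0Rec F K k)] [Fact (∀ c, 0 < wBRec F K k c)] in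
/-- **`B(V₋) = 0` FOR THE JUNK-FAR FIELD `V₋ ≡ −1`** at the unit background: `B(V₋)(c) = (1∕i)·mlog((−1)·1⋆) = (1∕i)·mlog(−1) = 0` (§1).
[cite: Balaban1985Variational, (20) p.281 (the letter; the value is the tree's `tsum` junk)] -/
theorem BOfRecord_negOne :
    BOfRecord F 2 K k (1 : GaugeField (F.P K) 0 (SU 2)) levB (fun _ => suOfMat 2 (-1 : Matrix (Fin 2) (Fin 2) ℂ)) = 0 := by
  apply (NegSup.equiv _ _).injective
  rw [NegSup.equiv_zero]
  funext c
  rw [BOfRecord_apply, avOfRecord_iter_one, Pi.zero_apply]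
  have h1 : ((1 : GaugeField (F.P K) k (SU 2)) c : Matrix (Fin 2) (Fin 2) ℂ) = 1 := rfl
  rw [h1, star_one, mul_one]
  change (Complex.I⁻¹ : ℂ) • mlog ((suOfMat 2 (-1 : Matrix (Fin 2) (Fin 2) ℂ) : SU 2) : Matrix (Fin 2) (Fin 2) ℂ) = 0
  rw [coe_suOfMat_neg_one, mlog_neg_one_eq_zero, smul_zero]

/-- **`𝔄(V₋) = 0`**: `𝔄 = H₁ ∘ B` (✓`frakAOfRecordAtBg128_eq`) and `B(V₋) = 0`. [cite: Balaban1985Variational, (103) p.293] -/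
theorem frakAOfRecordAtBg128_negOne :
    frakAOfRecordAtBg128 F 2 K k Ω (1 : GaugeField (F.P K) 0 (SU 2)) levB Gp Δ2 a hposπ hQ (fun _ => suOfMat 2 (-1 : Matrix (Fin 2) (Fin 2) ℂ)) = 0 := by
  rw [frakAOfRecordAtBg128_eq, BOfRecord_negOne, map_zero]

/-! ## §3–§4  The refutation -/

/-- ★★★ **THE FLAT ROAD's KNIT TOKENS (rng) ∧ (star_mem) ARE UNINHABITABLE** at `S_t := bgSchemeOfRecord F 2 K k Ω 1 {V | ‖𝔄 V‖ < t} …` for EVERY `t > 0`, every `Kc`, every other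
datum and every regularity `ε`: both `1` and `V₋ ≡ −1` lie in `S.dom` (`𝔄(1) = 0 = 𝔄(V₋)`), the scheme's data do not see `V` except through `𝔄`, so `S.chart V₋ (S.sol V₋) = S.chart 1 (S.sol 1)`,
and (rng) at the two points reads `Ū^k(that field) = 1` and `= V₋` — i.e. `(1 : SU(2)) = −1`.
[cite: Balaban1985Variational, Thm 1 p.279, (7) p.278, (20) p.281, (103) p.293, Prop. 6 (116) p.295 (the letters whose typed domain admits the junk point)] -/
theorem knitTokens_flatDom_false {t εC B₀ C₄ a₃ j a𝔄 ε₄ ε : ℝ} (ht : 0 < t)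
    (S : BgSchemeOnLit F 2 K k Ω 1)
    (hS : S = bgSchemeOfRecord F 2 K k Ω (1 : GaugeField (F.P K) 0 (SU 2))
      {V : GaugeField (F.P K) k (SU 2) | ‖frakAOfRecordAtBg128 F 2 K k Ω (1 : GaugeField (F.P K) 0 (SU 2)) levB Gp Δ2 a hposπ hQ V‖ < t}
      levB Gp Δ2 a hposπ hposb hQ εC B₀ C₄ a₃ j a𝔄 ε₄)
    (Kc : GaugeField (F.P K) k (SU 2) → Set (Space115Lit F 2 K k Ω 1))
    (range : ∀ V ∈ S.dom, ∀ A ∈ Kc V, S.chart V A ∈ bgReg F 2 K k ε ∧ Averaging.iter (avOfRecord F 2 K) k (S.chart V A) = V)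
    (star_mem : ∀ V ∈ S.dom, S.sol V ∈ Kc V) : False := by
  subst hS
  set Vneg : GaugeField (F.P K) k (SU 2) := fun _ => suOfMat 2 (-1 : Matrix (Fin 2) (Fin 2) ℂ) with hVneg
  have h𝔄neg := frakAOfRecordAtBg128_negOne F K k Ω levB a hposπ hQ (Gp := Gp) (Δ2 := Δ2)
  have h𝔄one := frakAOfRecordAtBg128_one F 2 K k Ω levB a hposπ hQ (Gp := Gp) (Δ2 := Δ2)
  -- both points lie in the domain
  have hneg_dom : Vneg ∈ (bgSchemeOfRecord F 2 K k Ω (1 : GaugeField (F.P K) 0 (SU 2))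
      {V : GaugeField (F.P K) k (SU 2) | ‖frakAOfRecordAtBg128 F 2 K k Ω (1 : GaugeField (F.P K) 0 (SU 2)) levB Gp Δ2 a hposπ hQ V‖ < t}
      levB Gp Δ2 a hposπ hposb hQ εC B₀ C₄ a₃ j a𝔄 ε₄).dom := by
    show ‖frakAOfRecordAtBg128 F 2 K k Ω (1 : GaugeField (F.P K) 0 (SU 2)) levB Gp Δ2 a hposπ hQ Vneg‖ < t
    rw [hVneg, h𝔄neg, norm_zero]; exact ht
  have hone_dom : (1 : GaugeField (F.P K) k (SU 2)) ∈ (bgSchemeOfRecord F 2 K k Ω (1 : GaugeField (F.P K) 0 (SU 2))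
      {V : GaugeField (F.P K) k (SU 2) | ‖frakAOfRecordAtBg128 F 2 K k Ω (1 : GaugeField (F.P K) 0 (SU 2)) levB Gp Δ2 a hposπ hQ V‖ < t}
      levB Gp Δ2 a hposπ hposb hQ εC B₀ C₄ a₃ j a𝔄 ε₄).dom := by
    show ‖frakAOfRecordAtBg128 F 2 K k Ω (1 : GaugeField (F.P K) 0 (SU 2)) levB Gp Δ2 a hposπ hQ 1‖ < t
    rw [h𝔄one, norm_zero]; exact ht
  -- the scheme sees `V` only through `𝔄(V)`: same fixed point, same chart
  set S := bgSchemeOfRecord F 2 K k Ω (1 : GaugeField (F.P K) 0 (SU 2))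
      {V : GaugeField (F.P K) k (SU 2) | ‖frakAOfRecordAtBg128 F 2 K k Ω (1 : GaugeField (F.P K) 0 (SU 2)) levB Gp Δ2 a hposπ hQ V‖ < t}
      levB Gp Δ2 a hposπ hposb hQ εC B₀ C₄ a₃ j a𝔄 ε₄ with hSdef
  have h𝔄S : S.𝔄 Vneg = S.𝔄 1 := by
    rw [hSdef, bgSchemeOfRecord_𝔄, bgSchemeOfRecord_𝔄, hVneg, h𝔄neg, h𝔄one]
  have hsol : S.sol Vneg = S.sol 1 := by
    show solA (S.𝒢 Vneg) 0 (S.W Vneg) (S.J Vneg) S.ε₄ (S.𝔄 Vneg) = solA (S.𝒢 1) 0 (S.W 1) (S.J 1) S.ε₄ (S.𝔄 1)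
    rw [h𝔄S]
    rfl
  have hchart : S.chart Vneg (S.sol Vneg) = S.chart 1 (S.sol 1) := by
    funext b
    rw [BgScheme.chart_apply, BgScheme.chart_apply, hsol]
    have hexpo : S.expoAt Vneg (S.sol 1) b = S.expoAt 1 (S.sol 1) b := by
      show exp (Complex.I • S.ev (S.sol 1 + S.𝔄 Vneg) b) = exp (Complex.I • S.ev (S.sol 1 + S.𝔄 1) b)
      rw [h𝔄S]
    rw [hexpo]
    rfl
  -- (rng) at the two points of the domain
  have e1 := (range 1 hone_dom _ (star_mem 1 hone_dom)).2
  have e2 := (range Vneg hneg_dom _ (star_mem Vneg hneg_dom)).2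
  rw [hchart, e1] at e2
  -- `1 = V₋` at any coarse bond
  have hb : (1 : GaugeField (F.P K) k (SU 2)) ⟨default, ⟨0, (F.P K).hd⟩⟩ = Vneg ⟨default, ⟨0, (F.P K).hd⟩⟩ := by rw [e2]
  have hmat : (1 : Matrix (Fin 2) (Fin 2) ℂ) = -1 := by
    have := congrArg (fun U : SU 2 => (U : Matrix (Fin 2) (Fin 2) ℂ)) hb
    simpa [hVneg, coe_suOfMat_neg_one] using this
  have h00 := congrFun (congrFun hmat 0) 0
  norm_num at h00

/-- ★★★ **HENCE: NO `Kc` CARRIES THE FLAT ROAD's KNIT PACKAGE AT `S_t`** (any `t > 0`, any data) — the finals of ✓p826658, ✓p826780, ✓p827017, ✓p827690 and ✓p828177 (all over this `S_t`,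
at level `k + 1`, `Δ2 := 0`) are VACUOUS-AS-TYPED. [cite: Balaban1985Variational, Thm 1 p.279, (7) p.278, (20) p.281] -/
theorem not_exists_knitTokens_flatDom {t εC B₀ C₄ a₃ j a𝔄 ε₄ ε : ℝ} (ht : 0 < t)
    (S : BgSchemeOnLit F 2 K k Ω 1)
    (hS : S = bgSchemeOfRecord F 2 K k Ω (1 : GaugeField (F.P K) 0 (SU 2))
      {V : GaugeField (F.P K) k (SU 2) | ‖frakAOfRecordAtBg128 F 2 K k Ω (1 : GaugeField (F.P K) 0 (SU 2)) levB Gp Δ2 a hposπ hQ V‖ < t}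
      levB Gp Δ2 a hposπ hposb hQ εC B₀ C₄ a₃ j a𝔄 ε₄) :
    ¬ ∃ Kc : GaugeField (F.P K) k (SU 2) → Set (Space115Lit F 2 K k Ω 1),
      (∀ V ∈ S.dom, ∀ A ∈ Kc V, S.chart V A ∈ bgReg F 2 K k ε ∧ Averaging.iter (avOfRecord F 2 K) k (S.chart V A) = V) ∧
      (∀ V ∈ S.dom, S.sol V ∈ Kc V) := by
  rintro ⟨Kc, range, star_mem⟩
  exact knitTokens_flatDom_false F K k Ω levB a hposπ hposb hQ ht S hS Kc range star_mem

end Record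

end Summit.QuantumFields.YangMills.Theorems.N07FlatDomKnitTokensNeg

end
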